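import Summits.CriticalPhenomena.PercolationContinuityZ3.Theorems.Transplant.SiteKNScheme
import Literature.Probability.Percolation.SitePaths
import HarnessLib

/-!
# SITE Kozma–Nitzan §4 — the geometry of Steps II–IV for the site scheme: reaching `M_x`, crossing the faces,
# the target

builds on p205010 (kernel theorem, internal audit signed; external expert review pending).
Lane `prim-bschramm`, class C1a (site percolation on `ℤ³`); block (γ) of the SITE same-`p` witness
(`SiteSameP.SiteSamePWitnessZd`, socket p217536), prim-hp-8 lineage.  Site twin of the scheme-dependent half of
`L/KozmaNitzanSteps.lean` (the static cell geometry there is imported verbatim).  Helper file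
(`--supports stmt-CriticalPhenomena-4575`); no sorries.

Two of the three deterministic ingredients of the supercriticality bound (33) for the examination of `v` from `w` along an
onward direction `x = v + du`, after a valid history of the SITE scheme (`SiteKNScheme.lean`):

* `reach_bound` — Step IV, first claim (p. 30): the site Lemma 12 (fed as a hypothesis, in the shape of
  `siteCorridorLemma_of_target`) applied to the weighting `Wfull` pinned on the recorded vertex pattern of `E_i` and
  restricted to `E_i ∪ E_{w,v} ∪ E_{v,x}`; the hypothesis of Lemma 12 is (32) of validity;
* `exists_face_prefix` — "to hit `M_x` via `H_{v,x}` you must pass through all the `F^j_{v,x}`" (p. 31), for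
  nearest-neighbour paths of OPEN VERTICES (`PathIn (zdGraph d) (Region ∩ σ)`), with the consequences
  `reach_subset_Aface`, `Aface_subset_Aface`;
(Step III, `cond_of_face`, is in `SiteKNStepIII.lean`.)
For site percolation there are no non-lattice pairs, so the bond bookkeeping of `lattOnly` disappears.
[cite: KozmaNitzan2024, §4 pp. 29–31 (Steps II–IV), Lemma 12 p. 23]
-/

noncomputable section

namespace Summit.CriticalPhenomena.PercolationContinuityZ3.Theorems.Transplant

namespace SiteKN

open MeasureTheory ProbabilityTheory
open Literature.Probability.Percolation Literature.Probability.LatticeModels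
open Literature.Probability.Percolation.KozmaNitzan Literature.Probability.Percolation.KozmaNitzan.Cells
open GadgetSystem ProbeHistory Contour
open SiteTransplant (siteConn mem_siteConn)
open scoped Classical

variable {d : ℕ}

namespace SKSch

variable (S : SKSch d)

/-! ## The setting of one examination -/

/-- The weighting pinned on the recorded vertex pattern of `E_i` and restricted to `E_i ∪ E_{w,v} ∪ E_{v,x}` (the site
weighting of KN's graph `Ω` restricted to `E_{w,v} ∪ E_{v,x}`, p. 28). [cite: KozmaNitzan2024, §4 p. 28 (Ω)] -/
def Wfull (h : ProbeHistory (Option (Site d))) (e : Site 2 × MDir) (du : MDir) : Site d → unitInterval :=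
  siteRestrW (↑(S.Sx h e du) : Set (Site d)) (pinW (fun _ : Site d => S.p) ↑(S.V h) ↑(S.ξ h))

/-- The event `{0 ↔^{site} M_x in E_i ∪ E_{w,v} ∪ H_{v,x}}`. [cite: KozmaNitzan2024, §4 p. 30 (Step IV)] -/
def Reach (h : ProbeHistory (Option (Site d))) (e : Site 2 × MDir) (du : MDir) : Set (SiteConfig (Site d)) :=
  ⋃ t ∈ (↑(S.C.M (tgt e + stepVec du)) : Set (Site d)),
    siteConnIn (zdGraph d) (↑(S.V h ∪ S.C.Ewv e.1 e.2 ∪ S.C.Hfull (tgt e) du) : Set (Site d)) (0 : Site d) t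

/-- The event `A'_j = {0 ↔^{site} F^{j+1}_{v,x} in E_i ∪ E_{w,v} ∪ H^{j+1}_{v,x}}`. [cite: KozmaNitzan2024, §4 p. 30 (B_j)] -/
def Aface (h : ProbeHistory (Option (Site d))) (e : Site 2 × MDir) (du : MDir) (j : ℕ) : Set (SiteConfig (Site d)) :=
  ⋃ t ∈ (↑(S.C.Face (tgt e) du (j + 1)) : Set (Site d)),
    siteConnIn (zdGraph d) (↑(S.Rj h e du (j + 1)) : Set (Site d)) (0 : Site d) t

variable {S}

section Setting

variable {h : ProbeHistory (Option (Site d))} {e : Site 2 × MDir} (hV : S.Valid h e) {du : MDir}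
  (hdu : du ∈ S.onward h (tgt e))
include hV hdu

omit hdu in
/-- The explored region is separated from `Q_v`. [cite: KozmaNitzan2024, §4 p. 26 (29)] -/
theorem Valid.sep_Q : KozmaNitzan.Sep (↑(S.V h) : Set (Site d)) ↑(S.C.Q (e.1 + stepVec e.2)) := by
  obtain ⟨det, hv, -, hsub⟩ := hV.cover
  exact (S.C.cover_sep_Q hv).mono hsub le_rfl

/-- The explored region is separated from `E_{v,x}`. [cite: KozmaNitzan2024, §4 p. 27 (31)] -/
theorem Valid.sep_Efar : KozmaNitzan.Sep (↑(S.V h) : Set (Site d)) ↑(S.C.Efar (e.1 + stepVec e.2) du) := by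
  obtain ⟨det, hv, hx, hsub⟩ := hV.cover
  exact (S.C.cover_sep_Efar hv (hx du hdu)).mono hsub le_rfl

/-- The reversed source direction is not an onward direction (site scheme). [folklore] -/
theorem Valid.rev_ne_du : rev e.2 ≠ du := by
  intro h
  have h1 := (Finset.mem_filter.1 hdu).2
  rw [← h] at h1
  apply h1
  have : tgt e + stepVec (rev e.2) = e.1 := tgt_tgt_rev e
  rw [this]
  exact hV.src_mem

/-- A vertex of `E_{v,x}` is not in `E_{w,v}` (site scheme). [folklore] -/
theorem Valid.not_mem_Ewv_of_mem_Efar {y : Site d} (hy : y ∈ S.C.Efar (tgt e) du) : y ∉ S.C.Ewv e.1 e.2 :=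
  fun hy' => S.C.Ewv_disjoint_Efar (w := e.1) (δw := e.2) (Valid.rev_ne_du hV hdu).symm hy' hy

/-- Neither the origin nor an explored vertex lies in `Q_v ∪ E_{v,x}` (site scheme). [folklore] -/
theorem Valid.not_mem_bigD_of_mem_V_or_zero {y : Site d} (hy : y ∈ S.V h ∨ y = 0) : y ∉ S.C.bigD (tgt e) du := by
  have hyV : y ∈ S.V h := hy.elim id fun h0 => h0 ▸ hV.zero_mem
  intro h0
  rcases S.C.mem_Q_or_Efar_of_mem_bigD h0 with h0 | h0
  · exact (Valid.sep_Q hV).not_mem (Finset.mem_coe.2 hyV) (Finset.mem_coe.2 h0)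
  · exact (Valid.sep_Efar hV hdu).not_mem (Finset.mem_coe.2 hyV) (Finset.mem_coe.2 h0)

/-! ## Step IV, first claim: `M_x` is reached through the corridor (site Lemma 12) -/

/-- The GEOMETRIC datum of Lemma 12 for the examination: direction `du`, centre `cen v`, scale `r`, support
`E_i ∪ E_{w,v} ∪ E_{v,x}`, source `0` (the bond weighting slot is unused and set to `0`; the site weighting is `Wfull`).
[cite: KozmaNitzan2024, §4 p. 31 (Lemma 12 with D = E_{v,x} ∪ Q_v)] -/
def cdOf (S : SKSch d) (h : ProbeHistory (Option (Site d))) (e : Site 2 × MDir) (du : MDir) : CData d :=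
  ⟨S.C.axOf du, sgOf du, sgOf_sign du, S.C.cen (tgt e), S.C.r, fun _ => 0, S.Sx h e du, 0⟩

/-- **The hypotheses of the site Lemma 12 hold for the examination datum.** [cite: KozmaNitzan2024, §4 p. 31] -/
theorem Valid.cd_hyp : SiteCHyp (cdOf S h e du) (S.Wfull h e du) S.p := by
  have hbigD : (cdOf S h e du).bigD = S.C.bigD (tgt e) du := rfl
  have hsub : S.C.bigD (tgt e) du ⊆ S.Sx h e du := by
    intro y hy
    rcases S.C.mem_Q_or_Efar_of_mem_bigD hy with hy | hy
    · exact Finset.mem_union_left _ (Finset.mem_union_right _ (Finset.mem_union_right _ hy))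
    · exact Finset.mem_union_right _ hy
  refine ⟨siteFinSupp_siteRestrW _ _, ?_, ?_, ?_, ?_⟩
  · rw [hbigD]
    change SiteIsSubbox (siteRestrW _ _) S.p _
    exact ((siteIsSubbox_const S.p (S.C.bigD (tgt e) du)).pinW
      (fun y hy hyV => Valid.not_mem_bigD_of_mem_V_or_zero hV hdu (Or.inl (Finset.mem_coe.1 hyV)) hy) _).siteRestrW
      (Finset.coe_subset.2 hsub)
  · rw [hbigD]; exact hsub
  · exact Finset.mem_union_left _ (Finset.mem_union_left _ hV.zero_mem)
  · rw [hbigD]; exact Valid.not_mem_bigD_of_mem_V_or_zero hV hdu (Or.inr rfl)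

/-- `A` of Lemma 12 is `E_i ∪ E_{w,v}`. [folklore] -/
theorem Valid.cd_Aset : S.V h ∪ S.C.Ewv e.1 e.2 = (cdOf S h e du).Aset := by
  change _ = S.Sx h e du \ S.C.Efar (tgt e) du
  ext y
  simp only [Sx, Finset.mem_sdiff, Finset.mem_union]
  constructor
  · rintro (hy | hy)
    · exact ⟨Or.inl (Or.inl hy), (Valid.sep_Efar hV hdu).not_mem (Finset.mem_coe.2 hy) ∘ Finset.mem_coe.2⟩
    · exact ⟨Or.inl (Or.inr hy), fun h => Valid.not_mem_Ewv_of_mem_Efar hV hdu h hy⟩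
  · rintro ⟨(hy | hy) | hy, hn⟩
    · exact Or.inl hy
    · exact Or.inr hy
    · exact absurd hy hn

omit hV hdu in
/-- The next centre of Lemma 12 is `cen x`. [folklore] -/
theorem cd_cnext : S.C.cen (tgt e + stepVec du) = (cdOf S h e du).cnext := by
  funext j
  change _ = (if j = S.C.axOf du then S.C.cen (tgt e) (S.C.axOf du) + 20 * (S.C.r : ℤ) * sgOf du else S.C.cen (tgt e) j)
  rw [S.C.cen_add_stepVec]
  by_cases hj : j = S.C.axOf du
  · subst hj; simp
  · rw [if_neg hj, if_neg hj]

/-- **Step IV, first claim** (KN p. 30–31): `P(0 ↔ M_x in E_i ∪ E_{w,v} ∪ H_{v,x} | sites of E_i) > 1 − ε'`, from (32)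
by the site Lemma 12 — here at scale `r` the hypothesis `hcorr`. [cite: KozmaNitzan2024, §4 pp. 30–31 (Step IV)] -/
theorem reach_bound {ε' : ℝ}
    (hcorr : ∀ (T : CData d) (w : Site d → unitInterval), SiteCHyp T w S.p → T.r = S.C.r →
      1 - S.δc < (prodBernoulli w).real
          (⋃ b ∈ Finset.Icc (T.c - ((3 * T.r : ℕ) : Site d)) (T.c + ((3 * T.r : ℕ) : Site d)),
            siteConnIn (zdGraph d) (↑T.Aset : Set (Site d)) T.o b) →
        1 - ε' < (prodBernoulli w).real
          (⋃ b ∈ T.Tn (3 * T.r), siteConnIn (zdGraph d) (↑T.Uset : Set (Site d)) T.o b)) :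
    1 - ε' < (prodBernoulli (S.Wfull h e du)).real (⋃ t ∈ (↑(S.C.M (tgt e + stepVec du)) : Set (Site d)),
      siteConnIn (zdGraph d) (↑(S.V h ∪ S.C.Ewv e.1 e.2 ∪ S.C.Hfull (tgt e) du) : Set (Site d)) (0 : Site d) t) := by
  set T := cdOf S h e du with hT
  have hA := Valid.cd_Aset hV hdu
  set A : Finset (Site d) := S.V h ∪ S.C.Ewv e.1 e.2 with hAdef
  have hAS : (↑A : Set (Site d)) ⊆ ↑(S.Sx h e du) := Finset.coe_subset.2 Finset.subset_union_left
  -- the hypothesis of Lemma 12 from (32)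
  have hreach := hV.reach
  have e1 : (prodBernoulli (S.W₀ h e)).real (⋃ t ∈ S.C.M (tgt e), siteConn (zdGraph d) (0 : Site d) t) =
      (prodBernoulli (pinW (fun _ : Site d => S.p) ↑(S.V h) ↑(S.ξ h))).real
        (⋃ t ∈ (↑(S.C.M (tgt e)) : Set (Site d)), siteConnIn (zdGraph d) (↑A : Set (Site d)) 0 t) := by
    rw [W₀, ← Finset.set_biUnion_coe, prodBernoulli_siteRestrW_real_biUnion_siteConn (zdGraph d)]
  have e2 : (prodBernoulli (S.Wfull h e du)).real (⋃ b ∈ Finset.Icc (T.c - ((3 * T.r : ℕ) : Site d))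
        (T.c + ((3 * T.r : ℕ) : Site d)), siteConnIn (zdGraph d) (↑T.Aset : Set (Site d)) T.o b) =
      (prodBernoulli (pinW (fun _ : Site d => S.p) ↑(S.V h) ↑(S.ξ h))).real
        (⋃ t ∈ (↑(S.C.M (tgt e)) : Set (Site d)), siteConnIn (zdGraph d) (↑A : Set (Site d)) 0 t) := by
    rw [← hA, ← Finset.set_biUnion_coe]
    change (prodBernoulli (siteRestrW _ _)).real _ = _
    exact prodBernoulli_siteRestrW_real_biUnion_siteConnIn (zdGraph d) _ hAS _ _
  have hyp : 1 - S.δc < (prodBernoulli (S.Wfull h e du)).real (⋃ b ∈ Finset.Icc (T.c - ((3 * T.r : ℕ) : Site d))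
      (T.c + ((3 * T.r : ℕ) : Site d)), siteConnIn (zdGraph d) (↑T.Aset : Set (Site d)) T.o b) := by
    rw [e2, ← e1]; exact hreach
  have concl := hcorr T (S.Wfull h e du) (Valid.cd_hyp hV hdu) rfl hyp
  -- read the conclusion
  have hU : (↑T.Uset : Set (Site d)) = ↑(S.V h ∪ S.C.Ewv e.1 e.2 ∪ S.C.Hfull (tgt e) du) := by
    change (↑(T.Aset ∪ S.C.Hfull (tgt e) du) : Set (Site d)) = _
    rw [← hA]
  have hTn : T.Tn (3 * T.r) = S.C.M (tgt e + stepVec du) := by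
    change Finset.Icc (T.cnext - ((3 * S.C.r : ℕ) : Site d)) (T.cnext + ((3 * S.C.r : ℕ) : Site d)) = _
    rw [← cd_cnext]; rfl
  rw [hTn, hU, ← Finset.set_biUnion_coe] at concl
  exact concl

/-! ## Crossing the faces -/

/-- **To reach beyond the level of `F^j` through the corridor one crosses `F^j`** (KN p. 31: "to hit `M_x` via
`H_{v,x}` you must pass through all the `F^j_{v,x}`"): a nearest-neighbour path inside `Rgn' ⊆ E_i ∪ E_{w,v} ∪ H_{v,x}`
from `0` to a point of `E_{v,x}` of level `> 5r + 10sj` (`1 ≤ j ≤ K`) has an initial segment inside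
`Rgn' ∩ (E_i ∪ E_{w,v} ∪ H^j_{v,x})` ending on `F^j_{v,x}`. [cite: KozmaNitzan2024, §4 p. 31 (Step IV)] -/
theorem exists_face_prefix {Rgn' : Set (Site d)}
    (hRgn : Rgn' ⊆ ↑(S.V h ∪ S.C.Ewv e.1 e.2 ∪ S.C.Hfull (tgt e) du))
    {z : Site d} (hz : z ∈ S.C.Efar (tgt e) du) {j : ℕ} (hj1 : 1 ≤ j)
    (hlev : 5 * (S.C.r : ℤ) + 10 * S.C.s * j + 1 ≤ sgOf du * (z (S.C.axOf du) - S.C.cen (tgt e) (S.C.axOf du)))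
    (hp : PathIn (zdGraph d) Rgn' 0 z) :
    ∃ a ∈ S.C.Face (tgt e) du j, PathIn (zdGraph d) (Rgn' ∩ ↑(S.Rj h e du j)) 0 a := by
  set v := tgt e with hv
  set ax := S.C.axOf du with hax
  set c := S.C.cen v ax with hc
  set L : ℤ := 5 * S.C.r + 10 * S.C.s * j with hLdef
  have hs1 : (1 : ℤ) ≤ S.C.s := by exact_mod_cast S.C.hs
  have hr1 : (1 : ℤ) ≤ S.C.r := by exact_mod_cast S.C.r_pos
  have hj1' : (1 : ℤ) ≤ j := by exact_mod_cast hj1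
  have hL5 : 5 * (S.C.r : ℤ) + 10 ≤ L := by rw [hLdef]; nlinarith
  set Past : Set (Site d) := {y | y ∈ S.C.Efar v du ∧ L + 1 ≤ sgOf du * (y ax - c)} with hPast
  have h0 : (0 : Site d) ∈ Pastᶜ := fun h0 =>
    (Valid.sep_Efar hV hdu).not_mem (Finset.mem_coe.2 hV.zero_mem) (Finset.mem_coe.2 h0.1)
  have hzP : z ∉ Pastᶜ := fun h' => h' ⟨hz, hlev⟩
  obtain ⟨a, b, ha, hb, hbR, hadj, hpa⟩ := hp.exit h0 hzP
  simp only [Set.mem_compl_iff, not_not] at hb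
  obtain ⟨hbE, hbl⟩ := hb
  have haR : a ∈ Rgn' := hpa.right_mem.2
  -- `b` is in the corridor (not explored, not in `E_{w,v}`)
  have hbH : b ∈ S.C.Hfull v du := by
    rcases Finset.mem_union.1 (hRgn hbR) with hb' | hb'
    · rcases Finset.mem_union.1 hb' with hb'' | hb''
      · exact absurd hbE ((Valid.sep_Efar hV hdu).not_mem (Finset.mem_coe.2 hb'') ∘ Finset.mem_coe.2)
      · exact absurd hb'' (Valid.not_mem_Ewv_of_mem_Efar hV hdu hbE)
    · exact hb'
  have hbH' := hbH
  rw [Cells.Hfull, mem_sBox_iff (sgOf_sign du)] at hbH'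
  obtain ⟨-, hbt⟩ := hbH'
  -- the level relation between `a` and `b`
  have hla := level_adj (a := ax) (sgOf_sign du) (S.C.cen v) hadj
  -- where is `a`?
  have haH : a ∈ S.C.Hfull v du ∧ sgOf du * (a ax - c) = L := by
    rcases Finset.mem_union.1 (hRgn haR) with ha' | ha'
    · rcases Finset.mem_union.1 ha' with ha'' | ha''
      · exact absurd hadj ((Valid.sep_Efar hV hdu) a (Finset.mem_coe.2 ha'') b (Finset.mem_coe.2 hbE)).2
      · rcases Finset.mem_union.1 ha'' with ha3 | ha3
        · -- `a ∈ Btw w δw = Btw v (rev δw)`: separated from `E_{v,x}`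
          rw [← S.C.Btw_rev] at ha3
          exact absurd hadj ((S.C.Btw_sep_Efar (v := e.1 + stepVec e.2) (Valid.rev_ne_du hV hdu))
            a (Finset.mem_coe.2 ha3) b (Finset.mem_coe.2 hbE)).2
        · -- `a ∈ Q_v`: level `≤ 5r`, but `b` has level `≥ L + 1 ≥ 5r + 11`
          exfalso
          obtain ⟨hal, -⟩ := S.C.level_of_mem_Q (δ := du) ha3
          change -(5 * (S.C.r : ℤ)) ≤ sgOf du * (a ax - c) ∧ sgOf du * (a ax - c) ≤ 5 * S.C.r at hal
          rcases hla with ⟨hl, -⟩ | ⟨hl, -⟩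
          · change sgOf du * (b ax - c) = sgOf du * (a ax - c) at hl; linarith [hal.2]
          · change sgOf du * (b ax - c) = sgOf du * (a ax - c) + 1 ∨ sgOf du * (b ax - c) = sgOf du * (a ax - c) - 1 at hl
            rcases hl with hl | hl <;> linarith [hal.2]
    · have hal : sgOf du * (a ax - c) ≤ L :=
        KSch.level_le_of_mem_Hfull_of_not_past (S := S.toKSch) (e := e) (du := du) ha' (by linarith) ha
      refine ⟨ha', le_antisymm hal ?_⟩
      rcases hla with ⟨hl, -⟩ | ⟨hl, -⟩
      · change sgOf du * (b ax - c) = sgOf du * (a ax - c) at hl; linarith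
      · change sgOf du * (b ax - c) = sgOf du * (a ax - c) + 1 ∨ sgOf du * (b ax - c) = sgOf du * (a ax - c) - 1 at hl
        rcases hl with hl | hl <;> linarith
  obtain ⟨haHf, haL⟩ := haH
  refine ⟨a, ?_, hpa.mono ?_⟩
  · rw [Cells.Hfull, mem_sBox_iff (sgOf_sign du)] at haHf
    rw [Cells.Face, mem_sBox_iff (sgOf_sign du)]
    exact ⟨⟨haL.ge, haL.le⟩, haHf.2⟩
  · -- the complement of `Past` inside `Rgn'` lies in `E_i ∪ E_{w,v} ∪ H^j`
    rintro y ⟨hyP, hyR⟩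
    refine ⟨hyR, ?_⟩
    rcases Finset.mem_union.1 (hRgn hyR) with hy' | hy'
    · exact Finset.mem_coe.2 (Finset.mem_union_left _ hy')
    · have hyl : sgOf du * (y ax - c) ≤ L :=
        KSch.level_le_of_mem_Hfull_of_not_past (S := S.toKSch) (e := e) (du := du) hy' (by linarith) hyP
      rw [Cells.Hfull, mem_sBox_iff (sgOf_sign du)] at hy'
      refine Finset.mem_coe.2 (Finset.mem_union_right _ ?_)
      rw [Cells.Stub, mem_sBox_iff (sgOf_sign du)]
      exact ⟨⟨hy'.1.1, hyl⟩, hy'.2⟩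

/-- **`Reach ⊆ A'_{K-1}`.** [cite: KozmaNitzan2024, §4 p. 31 (Step IV)] -/
theorem reach_subset_Aface {σ : SiteConfig (Site d)} (hR : σ ∈ S.Reach h e du) : σ ∈ S.Aface h e du (S.C.K - 1) := by
  have hK1 : 1 ≤ S.C.K := by have := S.C.hK; omega
  have hKK : S.C.K - 1 + 1 = S.C.K := by omega
  simp only [Reach, Set.mem_iUnion, exists_prop, Finset.mem_coe] at hR
  obtain ⟨t, ht, hpath⟩ := hR
  rw [mem_siteConnIn_iff_pathIn] at hpath
  obtain ⟨hl, -⟩ := S.C.level_of_mem_M_tgt ht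
  have hr1 : (1 : ℤ) ≤ S.C.r := by exact_mod_cast S.C.r_pos
  have hs20 : 20 * (S.C.s : ℤ) ≤ S.C.r := by exact_mod_cast S.C.twenty_s_le_r
  have hrK : (S.C.r : ℤ) = S.C.K * S.C.s := by unfold Cells.r; push_cast; ring
  obtain ⟨a, ha, hpa⟩ := exists_face_prefix hV hdu Set.inter_subset_left (S.C.M_tgt_subset_Efar _ _ ht) hK1
    (by
      have : 10 * (S.C.s : ℤ) * (S.C.K : ℕ) = 10 * S.C.r := by rw [hrK]; ring
      rw [this]; linarith [hl.1]) hpath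
  simp only [Aface, Set.mem_iUnion, exists_prop, Finset.mem_coe, hKK]
  refine ⟨a, ha, ?_⟩
  rw [mem_siteConnIn_iff_pathIn]
  exact hpa.mono fun y hy => ⟨hy.2, hy.1.2⟩

/-- **`A'_j ⊆ A'_{j-1}`** (`1 ≤ j < K`). [cite: KozmaNitzan2024, §4 p. 31 (Step IV)] -/
theorem Aface_subset_Aface {j : ℕ} (hj1 : 1 ≤ j) (hjK : j < S.C.K) {σ : SiteConfig (Site d)}
    (hR : σ ∈ S.Aface h e du j) : σ ∈ S.Aface h e du (j - 1) := by
  have hjj : j - 1 + 1 = j := by omega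
  simp only [Aface, Set.mem_iUnion, exists_prop, Finset.mem_coe] at hR
  obtain ⟨t, ht, hpath⟩ := hR
  rw [mem_siteConnIn_iff_pathIn] at hpath
  have hsub : (↑(S.Rj h e du (j + 1)) : Set (Site d)) ∩ σ ⊆ ↑(S.V h ∪ S.C.Ewv e.1 e.2 ∪ S.C.Hfull (tgt e) du) :=
    Set.inter_subset_left.trans
      (Finset.coe_subset.2 (Finset.union_subset_union le_rfl (S.C.Stub_subset_Hfull _ _ (by omega))))
  have htE : t ∈ S.C.Efar (tgt e) du := by
    have hs1 : (1 : ℤ) ≤ S.C.s := by exact_mod_cast S.C.hs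
    have hrK : (S.C.r : ℤ) = S.C.K * S.C.s := by unfold Cells.r; push_cast; ring
    have hjK' : (j : ℤ) + 1 ≤ S.C.K := by exact_mod_cast hjK
    rw [Cells.Face, mem_sBox_iff (sgOf_sign du)] at ht
    rw [Cells.Efar, mem_sBox_iff (sgOf_sign du)]
    push_cast at ht
    refine ⟨⟨by nlinarith [ht.1.1], ?_⟩, fun i hi => ?_⟩
    · have : 10 * (S.C.s : ℤ) * (j + 1) ≤ 10 * S.C.s * S.C.K :=
        mul_le_mul_of_nonneg_left hjK' (by positivity)
      nlinarith [ht.1.2]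
    · have := ht.2 i hi; constructor <;> linarith [this.1, this.2]
  have hlev : 5 * (S.C.r : ℤ) + 10 * S.C.s * j + 1 ≤
      sgOf du * (t (S.C.axOf du) - S.C.cen (tgt e) (S.C.axOf du)) := by
    rw [Cells.Face, mem_sBox_iff (sgOf_sign du)] at ht
    push_cast at ht
    have hs1 : (1 : ℤ) ≤ S.C.s := by exact_mod_cast S.C.hs
    nlinarith [ht.1.1]
  obtain ⟨a, ha, hpa⟩ := exists_face_prefix hV hdu hsub htE hj1 hlev hpath
  simp only [Aface, Set.mem_iUnion, exists_prop, Finset.mem_coe, hjj]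
  refine ⟨a, ha, ?_⟩
  rw [mem_siteConnIn_iff_pathIn]
  exact hpa.mono fun y hy => ⟨hy.2, hy.1.2⟩

end Setting

end SKSch

end SiteKN

end Summit.CriticalPhenomena.PercolationContinuityZ3.Theorems.Transplant

end
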